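import Summits.FinalStateConjecture.FinalStateConjecture.Theorems.RecedingSphereBudgetsAlmostMonotoneLimit
import HarnessLib

/-!
# Birth skeleton (BC3) — crux `RecedingSphereBudgets.SpinFreezing` (stmt-FinalStateConjecture-17687, rank 4)
# line `birth` — the SECOND-LAW LINE (skeleton registrar planner-skel-stmt-FinalStateConjecture-17687-0,
# 2026-08-17; BC3 of run/shared/lean/lens3/_common/BC.md; published as `Cruxes/SpinFreezing/Lines/birth.lean`)

The crux is FIXED and concluded BY NAME:
`Summit.FinalStateConjecture.FinalStateConjecture.Theses.RecedingSphereBudgets.SpinFreezing` — under the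
shape-settled final era with drifting labels `Q′` (rev 14 block, shared verbatim with `MassFreezing`), every
spin label converges: `∀ i, ∃ aᵢ∞, aᵢ(τ) → aᵢ∞`.

## The cut (two named stubs + the route crux `MassFreezing` by name; composition kernel-checked)

The route header already records (refuter crux-attack, why-it-might-fail of S; tenure "retriage signal 2";
KILL CRITERIA "horizon-area convergence plus a one-sided first-law budget") that S and M are tied together by
the SECOND LAW: the Kerr horizon area `𝒜 = 4π(r₊² + a²) = 8π·M·r₊(M, a)` of the labelled hole is (almost)
non-decreasing and bounded, hence convergent, and then `a² = M² − (𝒜/(8πM) − M)²` converges as soon as `M`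
does; the SIGN of `a` is then frozen by continuity (a continuous function whose square converges to `q > 0`
is eventually of one sign — intermediate value theorem; `q = 0` gives `a → 0`).  So on this line S is exactly
"M + the second law read in the drifting labels", and the second law splits along its two classical halves:

* `stub_innerCollarSwallowed` (T, HORIZON TRACKING FROM INSIDE; size L): under `Q′`, for every hole `i` and
  every `ε > 0`, eventually in hole time `t`, no point of the collar chart slab `{t*ᵢ = t}` with Kerr–Schild
  radius `r ≤ r₊(Mᵢ(t), aᵢ(t)) − ε` lies in `O = J⁺(ιΣ) ∩ I⁻(charted late sets)`.  Together with the cheap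
  inclusion forced by `Q′` itself (`Ψᵢ(extᵢ) ⊆ O`: every point with `r > r₊(label)` IS in `O`) this pins the
  event horizon `∂O` inside hole chart `i` to the shell `r₊(label(t)) − ε < r ≤ r₊(label(t))`.  Content:
  (a) `C^k` shape convergence on truncated slabs pins the drifting label to the true near-zone geometry up to
  `o(1)` (two Kerr–Schild metrics with different `(M, a)` are `≳ |ΔM| + |Δa|` apart on any slab); (b) the
  generators of `∂I⁻(charted sets)` in the collar obey the outgoing-null radial law whose `r = r₊` orbit is
  REPELLING with rate `κ(M, a) ≥ κ₀(m₀, χ) > 0` (sub-extremality `|a| ≤ χM`, `χ < 1`), so under adiabatic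
  drift (all label derivatives `→ 0`) the horizon hugs `r₊(label(t))` within `O(sup_{t' ≥ t}|label′|) → 0`
  (Vaidya picture: `r_EH = 2m(v) + O(m ṁ)`); (c) points below the horizon do not reach `I⁻` of the exterior
  parts (causal bookkeeping in near-Kerr geometry).  Why it might fail: a `Q′`-development whose event horizon
  sits a definite distance INSIDE `r₊(label)` forever — e.g. labels overshooting the true parameters by a
  non-decaying amount while the `C^k` deviation still tends to `0` on every truncated slab (excluded only if
  the Kerr family is quantitatively identifiable from a slab, which is true but must be proved in the chart's
  gauge), or a horizon whose generators leave the collar chart.  Sources: HawkingEllis1973 (Prop. 9.2.1,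
  §9.3), arXiv:gr-qc/0001003 (Chruściel–Delay–Galloway–Howard, regularity of horizons), AshtekarKrishnan2004
  (dynamical horizons, §§2–4), arXiv:2104.08222 §1, DafermosLuk2017.
* `stub_labelAreaSecondLaw` (A, THE AREA THEOREM READ IN LABELS; size XL): under `Q′`, for every hole `i`
  satisfying the tracking conclusion of T, the label area `t ↦ Mᵢ(t)·r₊(Mᵢ(t), aᵢ(t))` (`= 𝒜ᵢ/8π`) is ALMOST
  NON-DECREASING: `∃ T₁ F, F → 0 ∧ ∀ T₁ ≤ t₁ ≤ t₂, Aᵢ(t₁) ≤ Aᵢ(t₂) + F(t₁)`.  Content: Hawking's area theorem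
  for the portion of the event horizon `∂O` in hole chart `i` (vacuum ⇒ null convergence condition; the
  generators stay in the collar by T and are future-complete there because the metric is `C^k`-close to
  sub-extremal Kerr, whose horizon generators are complete, so `θ ≥ 0` by the focusing argument on the
  achronal boundary `∂I⁻(charted sets)`; complete `𝓘⁺` and the rays clause make `I⁻(charted sets)` the
  physical exterior), the `C⁰ → C¹` upgrade of T's tracking (stable-manifold regularity of the generator
  flow near the non-degenerate horizon, `κ > 0`), and the computation `Area(∂O ∩ {t*ᵢ = t}) =
  8π Mᵢ(t) r₊(Mᵢ(t), aᵢ(t)) + o(1)` from `C^k` metric convergence on the collar; a non-decreasing function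
  plus an `o(1)` error is almost non-decreasing with corrector `F(t₁) = sup_{t₂ ≥ t₁} |e(t₂) − e(t₁)|/8π → 0`.
  Why it might fail: low-regularity horizons (the area theorem needs the Chruściel–Delay–Galloway–Howard
  framework; a merely `C⁰`-close wrinkled cross-section can carry MORE area than the Kerr sphere — area is
  only lower semicontinuous under `C⁰` convergence, so the `C¹` upgrade is load-bearing), generators entering
  the late horizon from outside the collar (new generators only ADD area — harmless for monotonicity but they
  must be shown to stop mattering for the identification), and the completeness-of-generators input.
  Sources: HawkingEllis1973 (Prop. 9.2.7 / the area theorem), BardeenCarterHawking1973, arXiv:gr-qc/0001003,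
  AshtekarKrishnan2004, AnderssonMarsSimon2008, AnderssonMarsMetzgerSimon2009, arXiv:0811.0354 §5.1.
* `MassFreezing` enters BY NAME (route crux #2, stmt-FinalStateConjecture-17686, the declared dependency of S in
  the route header `[deps: MassFreezing, …]`; an admissible registered obligation, not a stub of this file).

Composition `SpinFreezing_of : Sig.stub_innerCollarSwallowed → Sig.stub_labelAreaSecondLaw → MassFreezing →
SpinFreezing` is a REAL PROOF (no `sorry`): T feeds A; A's almost-monotone label area is bounded above by
`2/m₀²` (box), so it converges by the route's own landed support `AlmostMonotoneLimit`
(`Theorems.almostMonotoneLimit_proof`, applied to `−Aᵢ`); `MassFreezing` gives `Mᵢ → Mᵢ∞ ≥ m₀ > 0`; the identity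
`aᵢ² = Mᵢ² − (Aᵢ/Mᵢ − Mᵢ)²` (from `r₊ = M + √(M² − a²)`, `|a| ≤ χM ≤ M`) makes `aᵢ²` converge; and the
elementary lemma `tendsto_of_continuous_of_sq_tendsto` (continuity of the smooth label `aᵢ` + IVT) selects the
sign.  The `Sig.*` legend = the stub signatures verbatim, so that the implication has named binders; the
registered stubs themselves are DEF-FREE and self-contained (`open … in` + the verbatim `Q′` block of the crux,
with the conclusion placed inside the `let` scope so that the chart abbreviations `B i`, `p i` are available).

Why not the card's TORQUE line (K3: `|ΔJᵢ| ≤ C(χ)Mᵢ·(incident energy) + summable tidal torque`) for the birth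
certificate: its two stubs need notions Lean lacks today — an incident-energy / horizon angular-momentum flux of
the dynamical hole and a quasi-local spin comparable to `aᵢMᵢ` (the route's definition request (3), "requested
when S is split") — so they cannot yet be typed over existing declarations without smuggling the content into
an existential; it remains the alternative line for crux-ideate/crux-plan once those definitions land.  The
second-law line is the one the route header itself names for S (why-it-might-fail of stmt-17687: "horizon-area
convergence … gives S ⇔ M"), now typed.

Disproof.lean: none exists for this crux (`ledger crux ls stmt-FinalStateConjecture-17687`: no workfiles at
registration) — no `_false_without_` obligations to honour.  Negatives index (1 entry,
`not_UniformPhotonSphereChannels`): an unrelated photon-sphere ODE channel estimate; neither stub is an instance.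
BC3 probes (folder `bc/SpinFreezing_probe.lean`): `stub → SpinFreezing` and `stub → FinalStateConjecture` by
`first | exact? | simpa [stub] | (unfold stub; simpa) | aesop` FAIL for both stubs (and for `MassFreezing`).
-/

set_option linter.dupNamespace false
set_option linter.style.longLine false

open scoped Topology Manifold MeasureTheory ENNReal NNReal ContDiff
open Filter Set Function TopologicalSpace Literature.Geometry.Lorentzian

namespace Summit.FinalStateConjecture.FinalStateConjecture.Cruxes.SpinFreezing.Birth

open Summit.FinalStateConjecture.FinalStateConjecture.Theses.RecedingSphereBudgets (SpinFreezing MassFreezing)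

/-! ## Legend: the two stub statements as named propositions (verbatim the registered signatures) -/

/-- Statement of `stub_innerCollarSwallowed` (T): under `Q′`, for every hole `i` and `ε > 0`, eventually in hole
time `t` no point of the collar slab `{t*ᵢ = t}` with `r ≤ r₊(Mᵢ(t), aᵢ(t)) − ε` lies in `O`. -/
def Sig.stub_innerCollarSwallowed : Prop :=
  open Literature.Geometry.Lorentzian Summit.FinalStateConjecture TopologicalSpace in ∀ (X : Type) [TopologicalSpace X] [ChartedSpace E3 X] [IsManifold (𝓡 3) (⊤ : ℕ∞) X] [T2Space X] [SecondCountableTopology X] [ConnectedSpace X], ∀ D ∈ admissibleVacuumData X, ∀ 𝒟 : VacuumCauchyDevelopment D, 𝒟.IsMaximal → HasCompleteNullInfinity 𝒟.toCauchyDevelopment → ∀ (N : ℕ) (m₀ χ τ₀ δ₀ : ℝ) (M a : Fin N → ℝ → ℝ) (motion : Fin N → lorentzGroup × E4) (U : Fin N → Opens E4) (Ψ : ∀ i, U i → 𝒟.carrier) (ρ : Fin N → ℝ → ℝ) (U₀ : Opens E4) (Ψ₀ : U₀ → 𝒟.carrier) (O : Set 𝒟.carrier), (let S := 𝒟.toSpacetime;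 let 𝒞 := 𝒟.toCauchyDevelopment; let J := 𝒟.metric.causalPast 𝒟.timeOrientation; let L := fun i ↦ ((motion i).1 : E4 ≃L[ℝ] E4); let p := fun i ↦ poincareInv (motion i).1 (motion i).2; let e := fun i ↦ L i (E4.basisVector 0); let B : Fin N → ModelBackground := fun i ↦ ⟨U i, fun x ↦ boostedKerrBilin (motion i).1 (motion i).2 (M i (p i x 0)) (a i (p i x 0)) x, fun x ↦ p i x 0, fun x ↦ Kerr.radius (a i (p i x 0)) (p i x)⟩; let ξ := fun i (t : ℝ) ↦ E4.spatial (((t - (motion i).2 0) / e i 0) • e i + (motion i).2); let B₀ := Minkowski.backgroundOn U₀; let h := S.deviationExtend B₀ Ψ₀; let ext := fun i ↦ (B i).lateRegion τ₀ ∩ {x | Kerr.rPlus (M i (p i x.1 0)) (a i (p i x.1 0)) < (B i).radius x.1}; ((0 < m₀ ∧ 0 ≤ χ ∧ χ < 1 ∧ 0 < δ₀ ∧ 2 * δ₀ < m₀) ∧ (∀ i, ContDiff ℝ (⊤ : ℕ∞) (M i) ∧ ContDiff ℝ (⊤ : ℕ∞) (a i) ∧ (∀ t, m₀ ≤ M i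 t ∧ M i t ≤ m₀⁻¹ ∧ |a i t| ≤ χ * M i t) ∧ ∀ n : ℕ, 1 ≤ n → Tendsto (iteratedDeriv n (M i)) atTop (𝓝 0) ∧ Tendsto (iteratedDeriv n (a i)) atTop (𝓝 0)) ∧ (∀ i, 0 < e i 0) ∧ Function.Injective e ∧ (∀ i, (U i : Set E4) = p i ⁻¹' {y : E4 | Kerr.rPlus (M i (y 0)) (a i (y 0)) - δ₀ < Kerr.radius (a i (y 0)) y}) ∧ (∀ i, S.IsLateChart (B i) Set.univ τ₀ (Ψ i) ∧ Ψ i '' ext i ⊆ O) ∧ (∀ i (k : ℕ) (R : ℝ), Tendsto (S.truncDeviationCk (B i) (Ψ i) k R) atTop (𝓝 0)) ∧ (∀ R : ℝ, ∃ τ₁, Pairwise (Disjoint on fun i ↦ Ψ i '' (B i).truncLateRegion τ₁ R)) ∧ (∀ i, Tendsto (fun t ↦ ρ i t / t) atTop (𝓝 0)) ∧ {x : E4 | τ₀ < x 0 ∧ ∀ i, ρ i (x 0) < E4.spatialNorm (p i x)} ⊆ ↑U₀ ∧ S.IsLateChart B₀ O τ₀ Ψ₀ ∧ Tendsto (S.deviationCk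 B₀ Ψ₀ 2) atTop (𝓝 0) ∧ O = exteriorOf 𝒞 (Ψ₀ '' B₀.lateRegion τ₀ ∪ ⋃ i, Ψ i '' ext i) ∧ (∀ τ₁ ≥ τ₀, RaysStayInClosure 𝒞 (exteriorOf 𝒞 (Ψ₀ '' B₀.lateRegion τ₁))) ∧ (∀ i (ϱ : ℝ), ∀ᶠ τ in atTop, ∀ x ∈ (B i).truncTimeSlab ϱ τ, 𝒟.timeOrientation.IsFutureDirected (mfderiv 𝓘(ℝ, E4) (𝓡 4) (Ψ i) x (L i (Kerr.timeVector (M i (p i x.1 0)) (a i (p i x.1 0)) (p i x.1))))) ∧ (∀ᶠ τ in atTop, ∀ x ∈ B₀.timeSlab τ, 𝒟.timeOrientation.IsFutureDirected (mfderiv 𝓘(ℝ, E4) (𝓡 4) Ψ₀ x (E4.basisVector 0))) ∧ O \ ((⋃ i, Ψ i '' (B i).lateRegion τ₀) ∪ Ψ₀ '' B₀.lateRegion τ₀) ⊆ J ((⋃ i, Ψ i '' (B i).timeSlab τ₀) ∪ Ψ₀ '' B₀.timeSlab τ₀) ∧ (∃ C₁ C₂ : ℝ, ∀ i (x : U i)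 (y : U₀), τ₀ < (B i).time x.1 → Ψ i x = Ψ₀ y → ‖E4.spatial y.1 - ξ i (y.1 0)‖ ≤ C₂ * (B i).radius x.1 + C₁) ∧ (∃ C_W : ℝ, ∀ᶠ τ in atTop, ∀ x : U₀, x.1 0 = τ → let w := 1 + ⨅ i, ‖E4.spatial x.1 - ξ i τ‖; w ^ (9 / 10 : ℝ) * ‖h x.1‖ ≤ C_W ∧ ∀ m : ℕ, 1 ≤ m → m ≤ 2 → w * ‖iteratedFDeriv ℝ m h x.1‖ ≤ C_W) ∧ (∃ C_E : ℝ, ∀ᶠ τ in atTop, ∫⁻ y in {y : E3 | E4.ofTimeSpace τ y ∈ U₀}, ‖iteratedFDeriv ℝ 1 h (E4.ofTimeSpace τ y)‖ₑ ^ 2 ≤ ENNReal.ofReal C_E) ∧ ∃ R : Fin N → ℝ → ℝ, (∀ i, Tendsto (fun τ ↦ S.truncDeviationCk (B i) (Ψ i) 2 (R i τ) τ) atTop (𝓝 0)) ∧ ∀ τ₁ > τ₀, O \ (Ψ₀ '' B₀.lateRegion τ₁ ∪ ⋃ i, Ψ i '' {x | τ₁ < (B i).time x.1 ∧ (B i).radius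 x.1 ≤ R i ((B i).time x.1)}) ⊆ J (Ψ₀ '' B₀.timeSlab τ₁ ∪ ⋃ i, Ψ i '' (B i).truncTimeSlab (R i τ₁) τ₁)) → ∀ i, ∀ ε : ℝ, 0 < ε → ∀ᶠ t in atTop, ∀ x : U i, (B i).time x.1 = t → (B i).radius x.1 ≤ Kerr.rPlus (M i t) (a i t) - ε → Ψ i x ∉ O)

/-- Statement of `stub_labelAreaSecondLaw` (A): under `Q′`, for every hole `i` whose event horizon is tracked from
inside (T's conclusion), the label area `Mᵢ(t)·r₊(Mᵢ(t), aᵢ(t))` is almost non-decreasing with a corrector `→ 0`. -/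
def Sig.stub_labelAreaSecondLaw : Prop :=
  open Literature.Geometry.Lorentzian Summit.FinalStateConjecture TopologicalSpace in ∀ (X : Type) [TopologicalSpace X] [ChartedSpace E3 X] [IsManifold (𝓡 3) (⊤ : ℕ∞) X] [T2Space X] [SecondCountableTopology X] [ConnectedSpace X], ∀ D ∈ admissibleVacuumData X, ∀ 𝒟 : VacuumCauchyDevelopment D, 𝒟.IsMaximal → HasCompleteNullInfinity 𝒟.toCauchyDevelopment → ∀ (N : ℕ) (m₀ χ τ₀ δ₀ : ℝ) (M a : Fin N → ℝ → ℝ) (motion : Fin N → lorentzGroup × E4) (U : Fin N → Opens E4) (Ψ : ∀ i, U i → 𝒟.carrier) (ρ : Fin N → ℝ → ℝ) (U₀ : Opens E4) (Ψ₀ : U₀ → 𝒟.carrier) (O : Set 𝒟.carrier), (let S := 𝒟.toSpacetime; let 𝒞 := 𝒟.toCauchyDevelopment; let J := 𝒟.metric.causalPast 𝒟.timeOrientation; let L := fun i ↦ ((motion i).1 : E4 ≃L[ℝ] E4); let p := fun i ↦ poincareInv (motion i).1 (motion i).2; let e := fun i ↦ L i (E4.basisVector 0); let B : Fin N → ModelBackground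 := fun i ↦ ⟨U i, fun x ↦ boostedKerrBilin (motion i).1 (motion i).2 (M i (p i x 0)) (a i (p i x 0)) x, fun x ↦ p i x 0, fun x ↦ Kerr.radius (a i (p i x 0)) (p i x)⟩; let ξ := fun i (t : ℝ) ↦ E4.spatial (((t - (motion i).2 0) / e i 0) • e i + (motion i).2); let B₀ := Minkowski.backgroundOn U₀; let h := S.deviationExtend B₀ Ψ₀; let ext := fun i ↦ (B i).lateRegion τ₀ ∩ {x | Kerr.rPlus (M i (p i x.1 0)) (a i (p i x.1 0)) < (B i).radius x.1}; ((0 < m₀ ∧ 0 ≤ χ ∧ χ < 1 ∧ 0 < δ₀ ∧ 2 * δ₀ < m₀) ∧ (∀ i, ContDiff ℝ (⊤ : ℕ∞) (M i) ∧ ContDiff ℝ (⊤ : ℕ∞) (a i) ∧ (∀ t, m₀ ≤ M i t ∧ M i t ≤ m₀⁻¹ ∧ |a i t| ≤ χ * M i t) ∧ ∀ n : ℕ, 1 ≤ n → Tendsto (iteratedDeriv n (M i)) atTop (𝓝 0) ∧ Tendsto (iteratedDeriv n (a i)) atTop (𝓝 0)) ∧ (∀ i, 0 < e i 0) ∧ Function.Injective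 e ∧ (∀ i, (U i : Set E4) = p i ⁻¹' {y : E4 | Kerr.rPlus (M i (y 0)) (a i (y 0)) - δ₀ < Kerr.radius (a i (y 0)) y}) ∧ (∀ i, S.IsLateChart (B i) Set.univ τ₀ (Ψ i) ∧ Ψ i '' ext i ⊆ O) ∧ (∀ i (k : ℕ) (R : ℝ), Tendsto (S.truncDeviationCk (B i) (Ψ i) k R) atTop (𝓝 0)) ∧ (∀ R : ℝ, ∃ τ₁, Pairwise (Disjoint on fun i ↦ Ψ i '' (B i).truncLateRegion τ₁ R)) ∧ (∀ i, Tendsto (fun t ↦ ρ i t / t) atTop (𝓝 0)) ∧ {x : E4 | τ₀ < x 0 ∧ ∀ i, ρ i (x 0) < E4.spatialNorm (p i x)} ⊆ ↑U₀ ∧ S.IsLateChart B₀ O τ₀ Ψ₀ ∧ Tendsto (S.deviationCk B₀ Ψ₀ 2) atTop (𝓝 0) ∧ O = exteriorOf 𝒞 (Ψ₀ '' B₀.lateRegion τ₀ ∪ ⋃ i, Ψ i '' ext i) ∧ (∀ τ₁ ≥ τ₀, RaysStayInClosure 𝒞 (exteriorOf 𝒞 (Ψ₀ '' B₀.lateRegion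 τ₁))) ∧ (∀ i (ϱ : ℝ), ∀ᶠ τ in atTop, ∀ x ∈ (B i).truncTimeSlab ϱ τ, 𝒟.timeOrientation.IsFutureDirected (mfderiv 𝓘(ℝ, E4) (𝓡 4) (Ψ i) x (L i (Kerr.timeVector (M i (p i x.1 0)) (a i (p i x.1 0)) (p i x.1))))) ∧ (∀ᶠ τ in atTop, ∀ x ∈ B₀.timeSlab τ, 𝒟.timeOrientation.IsFutureDirected (mfderiv 𝓘(ℝ, E4) (𝓡 4) Ψ₀ x (E4.basisVector 0))) ∧ O \ ((⋃ i, Ψ i '' (B i).lateRegion τ₀) ∪ Ψ₀ '' B₀.lateRegion τ₀) ⊆ J ((⋃ i, Ψ i '' (B i).timeSlab τ₀) ∪ Ψ₀ '' B₀.timeSlab τ₀) ∧ (∃ C₁ C₂ : ℝ, ∀ i (x : U i) (y : U₀), τ₀ < (B i).time x.1 → Ψ i x = Ψ₀ y → ‖E4.spatial y.1 - ξ i (y.1 0)‖ ≤ C₂ * (B i).radius x.1 + C₁) ∧ (∃ C_W : ℝ, ∀ᶠ τ in atTop, ∀ x : U₀, x.1 0 = τ → let w := 1 + ⨅ i, ‖E4.spatial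 x.1 - ξ i τ‖; w ^ (9 / 10 : ℝ) * ‖h x.1‖ ≤ C_W ∧ ∀ m : ℕ, 1 ≤ m → m ≤ 2 → w * ‖iteratedFDeriv ℝ m h x.1‖ ≤ C_W) ∧ (∃ C_E : ℝ, ∀ᶠ τ in atTop, ∫⁻ y in {y : E3 | E4.ofTimeSpace τ y ∈ U₀}, ‖iteratedFDeriv ℝ 1 h (E4.ofTimeSpace τ y)‖ₑ ^ 2 ≤ ENNReal.ofReal C_E) ∧ ∃ R : Fin N → ℝ → ℝ, (∀ i, Tendsto (fun τ ↦ S.truncDeviationCk (B i) (Ψ i) 2 (R i τ) τ) atTop (𝓝 0)) ∧ ∀ τ₁ > τ₀, O \ (Ψ₀ '' B₀.lateRegion τ₁ ∪ ⋃ i, Ψ i '' {x | τ₁ < (B i).time x.1 ∧ (B i).radius x.1 ≤ R i ((B i).time x.1)}) ⊆ J (Ψ₀ '' B₀.timeSlab τ₁ ∪ ⋃ i, Ψ i '' (B i).truncTimeSlab (R i τ₁) τ₁)) → ∀ i, (∀ ε : ℝ, 0 < ε → ∀ᶠ t in atTop, ∀ x : U i, (B i).time x.1 = t → (B i).radius x.1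 ≤ Kerr.rPlus (M i t) (a i t) - ε → Ψ i x ∉ O) → ∃ (T₁ : ℝ) (F : ℝ → ℝ), Tendsto F atTop (𝓝 0) ∧ ∀ t₁ t₂ : ℝ, T₁ ≤ t₁ → t₁ ≤ t₂ → M i t₁ * Kerr.rPlus (M i t₁) (a i t₁) ≤ M i t₂ * Kerr.rPlus (M i t₂) (a i t₂) + F t₁)

/-! ## Registered stubs (`sorry` only here; signatures def-free and self-contained) -/

/-- **T — THE INNER COLLAR IS SWALLOWED (event horizon tracked from inside by the labelled outer radius).**
Under `Q′`: `∀ i, ∀ ε > 0, ∀ᶠ t → ∞, ∀ x` in hole chart `i` with `t*ᵢ(x) = t` and `rᵢ(x) ≤ r₊(Mᵢ t, aᵢ t) − ε`,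
`Ψᵢ x ∉ O`.  Label identifiability from `C^k` slab convergence + repelling near-horizon null dynamics
(`κ ≥ κ₀(m₀, χ) > 0`) under adiabatic drift + causal bookkeeping.  Why it might fail: labels overshooting the
true parameters by a non-decaying amount compatible with slab convergence; generators leaving the collar.
Sources: HawkingEllis1973 §9.2–9.3, arXiv:gr-qc/0001003, AshtekarKrishnan2004, arXiv:2104.08222, DafermosLuk2017.
Size: L. -/
theorem stub_innerCollarSwallowed : open Literature.Geometry.Lorentzian Summit.FinalStateConjecture TopologicalSpace in ∀ (X : Type) [TopologicalSpace X] [ChartedSpace E3 X] [IsManifold (𝓡 3) (⊤ : ℕ∞) X] [T2Space X] [SecondCountableTopology X] [ConnectedSpace X], ∀ D ∈ admissibleVacuumData X, ∀ 𝒟 : VacuumCauchyDevelopment D, 𝒟.IsMaximal → HasCompleteNullInfinity 𝒟.toCauchyDevelopment → ∀ (N : ℕ) (m₀ χ τ₀ δ₀ : ℝ) (M a : Fin N → ℝ → ℝ) (motion : Fin N → lorentzGroup × E4) (U : Fin N → Opens E4) (Ψ : ∀ i, U i → 𝒟.carrier) (ρ : Fin N → ℝ → ℝ) (U₀ : Opens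 E4) (Ψ₀ : U₀ → 𝒟.carrier) (O : Set 𝒟.carrier), (let S := 𝒟.toSpacetime; let 𝒞 := 𝒟.toCauchyDevelopment; let J := 𝒟.metric.causalPast 𝒟.timeOrientation; let L := fun i ↦ ((motion i).1 : E4 ≃L[ℝ] E4); let p := fun i ↦ poincareInv (motion i).1 (motion i).2; let e := fun i ↦ L i (E4.basisVector 0); let B : Fin N → ModelBackground := fun i ↦ ⟨U i, fun x ↦ boostedKerrBilin (motion i).1 (motion i).2 (M i (p i x 0)) (a i (p i x 0)) x, fun x ↦ p i x 0, fun x ↦ Kerr.radius (a i (p i x 0)) (p i x)⟩; let ξ := fun i (t : ℝ) ↦ E4.spatial (((t - (motion i).2 0) / e i 0) • e i + (motion i).2); let B₀ := Minkowski.backgroundOn U₀; let h := S.deviationExtend B₀ Ψ₀; let ext := fun i ↦ (B i).lateRegion τ₀ ∩ {x | Kerr.rPlus (M i (p i x.1 0)) (a i (p i x.1 0)) < (B i).radius x.1}; ((0 < m₀ ∧ 0 ≤ χ ∧ χ < 1 ∧ 0 < δ₀ ∧ 2 * δ₀ < m₀) ∧ (∀ i, ContDiff ℝ (⊤ : ℕ∞)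 (M i) ∧ ContDiff ℝ (⊤ : ℕ∞) (a i) ∧ (∀ t, m₀ ≤ M i t ∧ M i t ≤ m₀⁻¹ ∧ |a i t| ≤ χ * M i t) ∧ ∀ n : ℕ, 1 ≤ n → Tendsto (iteratedDeriv n (M i)) atTop (𝓝 0) ∧ Tendsto (iteratedDeriv n (a i)) atTop (𝓝 0)) ∧ (∀ i, 0 < e i 0) ∧ Function.Injective e ∧ (∀ i, (U i : Set E4) = p i ⁻¹' {y : E4 | Kerr.rPlus (M i (y 0)) (a i (y 0)) - δ₀ < Kerr.radius (a i (y 0)) y}) ∧ (∀ i, S.IsLateChart (B i) Set.univ τ₀ (Ψ i) ∧ Ψ i '' ext i ⊆ O) ∧ (∀ i (k : ℕ) (R : ℝ), Tendsto (S.truncDeviationCk (B i) (Ψ i) k R) atTop (𝓝 0)) ∧ (∀ R : ℝ, ∃ τ₁, Pairwise (Disjoint on fun i ↦ Ψ i '' (B i).truncLateRegion τ₁ R)) ∧ (∀ i, Tendsto (fun t ↦ ρ i t / t) atTop (𝓝 0)) ∧ {x : E4 | τ₀ < x 0 ∧ ∀ i, ρ i (x 0) < E4.spatialNorm (p i x)}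 ⊆ ↑U₀ ∧ S.IsLateChart B₀ O τ₀ Ψ₀ ∧ Tendsto (S.deviationCk B₀ Ψ₀ 2) atTop (𝓝 0) ∧ O = exteriorOf 𝒞 (Ψ₀ '' B₀.lateRegion τ₀ ∪ ⋃ i, Ψ i '' ext i) ∧ (∀ τ₁ ≥ τ₀, RaysStayInClosure 𝒞 (exteriorOf 𝒞 (Ψ₀ '' B₀.lateRegion τ₁))) ∧ (∀ i (ϱ : ℝ), ∀ᶠ τ in atTop, ∀ x ∈ (B i).truncTimeSlab ϱ τ, 𝒟.timeOrientation.IsFutureDirected (mfderiv 𝓘(ℝ, E4) (𝓡 4) (Ψ i) x (L i (Kerr.timeVector (M i (p i x.1 0)) (a i (p i x.1 0)) (p i x.1))))) ∧ (∀ᶠ τ in atTop, ∀ x ∈ B₀.timeSlab τ, 𝒟.timeOrientation.IsFutureDirected (mfderiv 𝓘(ℝ, E4) (𝓡 4) Ψ₀ x (E4.basisVector 0))) ∧ O \ ((⋃ i, Ψ i '' (B i).lateRegion τ₀) ∪ Ψ₀ '' B₀.lateRegion τ₀) ⊆ J ((⋃ i, Ψ i '' (B i).timeSlab τ₀) ∪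 Ψ₀ '' B₀.timeSlab τ₀) ∧ (∃ C₁ C₂ : ℝ, ∀ i (x : U i) (y : U₀), τ₀ < (B i).time x.1 → Ψ i x = Ψ₀ y → ‖E4.spatial y.1 - ξ i (y.1 0)‖ ≤ C₂ * (B i).radius x.1 + C₁) ∧ (∃ C_W : ℝ, ∀ᶠ τ in atTop, ∀ x : U₀, x.1 0 = τ → let w := 1 + ⨅ i, ‖E4.spatial x.1 - ξ i τ‖; w ^ (9 / 10 : ℝ) * ‖h x.1‖ ≤ C_W ∧ ∀ m : ℕ, 1 ≤ m → m ≤ 2 → w * ‖iteratedFDeriv ℝ m h x.1‖ ≤ C_W) ∧ (∃ C_E : ℝ, ∀ᶠ τ in atTop, ∫⁻ y in {y : E3 | E4.ofTimeSpace τ y ∈ U₀}, ‖iteratedFDeriv ℝ 1 h (E4.ofTimeSpace τ y)‖ₑ ^ 2 ≤ ENNReal.ofReal C_E) ∧ ∃ R : Fin N → ℝ → ℝ, (∀ i, Tendsto (fun τ ↦ S.truncDeviationCk (B i) (Ψ i) 2 (R i τ) τ) atTop (𝓝 0)) ∧ ∀ τ₁ > τ₀, O \ (Ψ₀ '' B₀.lateRegion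 τ₁ ∪ ⋃ i, Ψ i '' {x | τ₁ < (B i).time x.1 ∧ (B i).radius x.1 ≤ R i ((B i).time x.1)}) ⊆ J (Ψ₀ '' B₀.timeSlab τ₁ ∪ ⋃ i, Ψ i '' (B i).truncTimeSlab (R i τ₁) τ₁)) → ∀ i, ∀ ε : ℝ, 0 < ε → ∀ᶠ t in atTop, ∀ x : U i, (B i).time x.1 = t → (B i).radius x.1 ≤ Kerr.rPlus (M i t) (a i t) - ε → Ψ i x ∉ O) := by
  sorry

/-- **A — THE AREA THEOREM READ IN THE DRIFTING LABELS.**  Under `Q′`, for every hole `i` satisfying T's tracking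
conclusion, `t ↦ Mᵢ(t)·r₊(Mᵢ(t), aᵢ(t))` (`= Area/8π` of the labelled Kerr horizon) is almost non-decreasing:
`∃ T₁ F, F → 0 ∧ ∀ T₁ ≤ t₁ ≤ t₂, Aᵢ t₁ ≤ Aᵢ t₂ + F t₁`.  Hawking's area theorem on `∂O` ∩ (hole chart `i`)
(vacuum NEC, complete generators near sub-extremal Kerr, complete `𝓘⁺`), `C⁰ → C¹` upgrade of the tracking
(stable-manifold regularity, `κ > 0`), and `Area = 8π Mᵢ r₊ + o(1)` from `C^k` collar convergence.  Why it might
fail: low-regularity horizons (area only lower semicontinuous under `C⁰` closeness; the `C¹` upgrade is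
load-bearing), generator completeness.  Sources: HawkingEllis1973 (area theorem), BardeenCarterHawking1973,
arXiv:gr-qc/0001003, AshtekarKrishnan2004, AnderssonMarsMetzgerSimon2009, arXiv:0811.0354 §5.1.  Size: XL. -/
theorem stub_labelAreaSecondLaw : open Literature.Geometry.Lorentzian Summit.FinalStateConjecture TopologicalSpace in ∀ (X : Type) [TopologicalSpace X] [ChartedSpace E3 X] [IsManifold (𝓡 3) (⊤ : ℕ∞) X] [T2Space X] [SecondCountableTopology X] [ConnectedSpace X], ∀ D ∈ admissibleVacuumData X, ∀ 𝒟 : VacuumCauchyDevelopment D, 𝒟.IsMaximal → HasCompleteNullInfinity 𝒟.toCauchyDevelopment → ∀ (N : ℕ) (m₀ χ τ₀ δ₀ : ℝ) (M a : Fin N → ℝ → ℝ) (motion : Fin N → lorentzGroup × E4) (U : Fin N → Opens E4) (Ψ : ∀ i, U i → 𝒟.carrier) (ρ : Fin N → ℝ → ℝ) (U₀ : Opens E4) (Ψ₀ : U₀ → 𝒟.carrier) (O : Set 𝒟.carrier), (let S := 𝒟.toSpacetime; let 𝒞 := 𝒟.toCauchyDevelopment; let J := 𝒟.metric.causalPast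 𝒟.timeOrientation; let L := fun i ↦ ((motion i).1 : E4 ≃L[ℝ] E4); let p := fun i ↦ poincareInv (motion i).1 (motion i).2; let e := fun i ↦ L i (E4.basisVector 0); let B : Fin N → ModelBackground := fun i ↦ ⟨U i, fun x ↦ boostedKerrBilin (motion i).1 (motion i).2 (M i (p i x 0)) (a i (p i x 0)) x, fun x ↦ p i x 0, fun x ↦ Kerr.radius (a i (p i x 0)) (p i x)⟩; let ξ := fun i (t : ℝ) ↦ E4.spatial (((t - (motion i).2 0) / e i 0) • e i + (motion i).2); let B₀ := Minkowski.backgroundOn U₀; let h := S.deviationExtend B₀ Ψ₀; let ext := fun i ↦ (B i).lateRegion τ₀ ∩ {x | Kerr.rPlus (M i (p i x.1 0)) (a i (p i x.1 0)) < (B i).radius x.1}; ((0 < m₀ ∧ 0 ≤ χ ∧ χ < 1 ∧ 0 < δ₀ ∧ 2 * δ₀ < m₀) ∧ (∀ i, ContDiff ℝ (⊤ : ℕ∞) (M i) ∧ ContDiff ℝ (⊤ : ℕ∞) (a i) ∧ (∀ t, m₀ ≤ M i t ∧ M i t ≤ m₀⁻¹ ∧ |a i t| ≤ χ * M i t) ∧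 ∀ n : ℕ, 1 ≤ n → Tendsto (iteratedDeriv n (M i)) atTop (𝓝 0) ∧ Tendsto (iteratedDeriv n (a i)) atTop (𝓝 0)) ∧ (∀ i, 0 < e i 0) ∧ Function.Injective e ∧ (∀ i, (U i : Set E4) = p i ⁻¹' {y : E4 | Kerr.rPlus (M i (y 0)) (a i (y 0)) - δ₀ < Kerr.radius (a i (y 0)) y}) ∧ (∀ i, S.IsLateChart (B i) Set.univ τ₀ (Ψ i) ∧ Ψ i '' ext i ⊆ O) ∧ (∀ i (k : ℕ) (R : ℝ), Tendsto (S.truncDeviationCk (B i) (Ψ i) k R) atTop (𝓝 0)) ∧ (∀ R : ℝ, ∃ τ₁, Pairwise (Disjoint on fun i ↦ Ψ i '' (B i).truncLateRegion τ₁ R)) ∧ (∀ i, Tendsto (fun t ↦ ρ i t / t) atTop (𝓝 0)) ∧ {x : E4 | τ₀ < x 0 ∧ ∀ i, ρ i (x 0) < E4.spatialNorm (p i x)} ⊆ ↑U₀ ∧ S.IsLateChart B₀ O τ₀ Ψ₀ ∧ Tendsto (S.deviationCk B₀ Ψ₀ 2) atTop (𝓝 0) ∧ O = exteriorOf 𝒞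 (Ψ₀ '' B₀.lateRegion τ₀ ∪ ⋃ i, Ψ i '' ext i) ∧ (∀ τ₁ ≥ τ₀, RaysStayInClosure 𝒞 (exteriorOf 𝒞 (Ψ₀ '' B₀.lateRegion τ₁))) ∧ (∀ i (ϱ : ℝ), ∀ᶠ τ in atTop, ∀ x ∈ (B i).truncTimeSlab ϱ τ, 𝒟.timeOrientation.IsFutureDirected (mfderiv 𝓘(ℝ, E4) (𝓡 4) (Ψ i) x (L i (Kerr.timeVector (M i (p i x.1 0)) (a i (p i x.1 0)) (p i x.1))))) ∧ (∀ᶠ τ in atTop, ∀ x ∈ B₀.timeSlab τ, 𝒟.timeOrientation.IsFutureDirected (mfderiv 𝓘(ℝ, E4) (𝓡 4) Ψ₀ x (E4.basisVector 0))) ∧ O \ ((⋃ i, Ψ i '' (B i).lateRegion τ₀) ∪ Ψ₀ '' B₀.lateRegion τ₀) ⊆ J ((⋃ i, Ψ i '' (B i).timeSlab τ₀) ∪ Ψ₀ '' B₀.timeSlab τ₀) ∧ (∃ C₁ C₂ : ℝ, ∀ i (x : U i) (y : U₀), τ₀ < (B i).time x.1 → Ψ i x = Ψ₀ y → ‖E4.spatial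 y.1 - ξ i (y.1 0)‖ ≤ C₂ * (B i).radius x.1 + C₁) ∧ (∃ C_W : ℝ, ∀ᶠ τ in atTop, ∀ x : U₀, x.1 0 = τ → let w := 1 + ⨅ i, ‖E4.spatial x.1 - ξ i τ‖; w ^ (9 / 10 : ℝ) * ‖h x.1‖ ≤ C_W ∧ ∀ m : ℕ, 1 ≤ m → m ≤ 2 → w * ‖iteratedFDeriv ℝ m h x.1‖ ≤ C_W) ∧ (∃ C_E : ℝ, ∀ᶠ τ in atTop, ∫⁻ y in {y : E3 | E4.ofTimeSpace τ y ∈ U₀}, ‖iteratedFDeriv ℝ 1 h (E4.ofTimeSpace τ y)‖ₑ ^ 2 ≤ ENNReal.ofReal C_E) ∧ ∃ R : Fin N → ℝ → ℝ, (∀ i, Tendsto (fun τ ↦ S.truncDeviationCk (B i) (Ψ i) 2 (R i τ) τ) atTop (𝓝 0)) ∧ ∀ τ₁ > τ₀, O \ (Ψ₀ '' B₀.lateRegion τ₁ ∪ ⋃ i, Ψ i '' {x | τ₁ < (B i).time x.1 ∧ (B i).radius x.1 ≤ R i ((B i).time x.1)}) ⊆ J (Ψ₀ '' B₀.timeSlab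 τ₁ ∪ ⋃ i, Ψ i '' (B i).truncTimeSlab (R i τ₁) τ₁)) → ∀ i, (∀ ε : ℝ, 0 < ε → ∀ᶠ t in atTop, ∀ x : U i, (B i).time x.1 = t → (B i).radius x.1 ≤ Kerr.rPlus (M i t) (a i t) - ε → Ψ i x ∉ O) → ∃ (T₁ : ℝ) (F : ℝ → ℝ), Tendsto F atTop (𝓝 0) ∧ ∀ t₁ t₂ : ℝ, T₁ ≤ t₁ → t₁ ≤ t₂ → M i t₁ * Kerr.rPlus (M i t₁) (a i t₁) ≤ M i t₂ * Kerr.rPlus (M i t₂) (a i t₂) + F t₁) := by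
  sorry

/-! ## Elementary glue (fully proved): sign selection and the label algebra -/

/-- A continuous real function on `ℝ` whose square converges at `+∞` converges at `+∞`: `|f| → √q`; if `√q = 0`
then `f → 0`, otherwise `f` is eventually bounded away from `0`, hence eventually of one sign by the
intermediate value theorem, and `f → ±√q`. -/
theorem tendsto_of_continuous_of_sq_tendsto {f : ℝ → ℝ} (hf : Continuous f) {q : ℝ}
    (hsq : Tendsto (fun t ↦ f t ^ 2) atTop (𝓝 q)) : ∃ l : ℝ, Tendsto f atTop (𝓝 l) := by
  have habs : Tendsto (fun t ↦ |f t|) atTop (𝓝 (√q)) := by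
    have h := (Real.continuous_sqrt.tendsto q).comp hsq
    have h' : (Real.sqrt ∘ fun t ↦ f t ^ 2) = fun t ↦ |f t| := by
      funext t
      simp [Function.comp, Real.sqrt_sq_eq_abs]
    rw [h'] at h
    exact h
  by_cases hL : √q = 0
  · refine ⟨0, ?_⟩
    rw [hL] at habs
    exact squeeze_zero_norm (fun t ↦ (Real.norm_eq_abs (f t)).le) habs
  · have hLpos : 0 < √q := lt_of_le_of_ne (Real.sqrt_nonneg q) (Ne.symm hL)
    obtain ⟨T, hT⟩ := eventually_atTop.1 (habs.eventually (lt_mem_nhds (half_lt_self hLpos)))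
    have hne : ∀ t, T ≤ t → f t ≠ 0 := by
      intro t ht h0
      have h1 := hT t ht
      rw [h0, abs_zero] at h1
      linarith
    rcases lt_or_gt_of_ne (hne T le_rfl) with hneg | hpos
    · have hsign : ∀ t, T ≤ t → f t < 0 := by
        intro t ht
        by_contra h
        have h' : 0 ≤ f t := not_lt.mp h
        obtain ⟨c, hc, hc0⟩ : (0 : ℝ) ∈ f '' Set.Icc T t :=
          intermediate_value_Icc ht hf.continuousOn ⟨hneg.le, h'⟩
        exact hne c hc.1 hc0
      refine ⟨-√q, ?_⟩
      refine habs.neg.congr' ?_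
      filter_upwards [eventually_ge_atTop T] with t ht
      rw [abs_of_neg (hsign t ht), neg_neg]
    · have hsign : ∀ t, T ≤ t → 0 < f t := by
        intro t ht
        by_contra h
        have h' : f t ≤ 0 := not_lt.mp h
        obtain ⟨c, hc, hc0⟩ : (0 : ℝ) ∈ f '' Set.Icc T t :=
          intermediate_value_Icc' ht hf.continuousOn ⟨h', hpos.le⟩
        exact hne c hc.1 hc0
      refine ⟨√q, habs.congr' ?_⟩
      filter_upwards [eventually_ge_atTop T] with t ht
      exact abs_of_pos (hsign t ht)

/-- **Labels: mass convergence + almost-monotone label area ⇒ spin convergence.**  For labels in the box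
`m₀ ≤ M ≤ 1/m₀`, `|a| ≤ χM`, `χ < 1`, with `a` continuous: if `M → Minf` and the label area
`A(t) = M(t)·r₊(M(t), a(t))` is almost non-decreasing with corrector `F → 0`, then `a` converges.  (`A ≤ 2/m₀²`,
so `A` converges by `AlmostMonotoneLimit` applied to `−A`; `a² = M² − (A/M − M)²`; sign by continuity.) -/
theorem spin_tendsto_of_mass_tendsto_of_labelArea {m₀ χ : ℝ} {M a : ℝ → ℝ} (hm₀ : 0 < m₀)
    (hχ : χ < 1) (ha : Continuous a) (hbox : ∀ t, m₀ ≤ M t ∧ M t ≤ m₀⁻¹ ∧ |a t| ≤ χ * M t)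
    {Minf : ℝ} (hM : Tendsto M atTop (𝓝 Minf)) {T₁ : ℝ} {F : ℝ → ℝ} (hF : Tendsto F atTop (𝓝 0))
    (hmono : ∀ t₁ t₂ : ℝ, T₁ ≤ t₁ → t₁ ≤ t₂ →
      M t₁ * Kerr.rPlus (M t₁) (a t₁) ≤ M t₂ * Kerr.rPlus (M t₂) (a t₂) + F t₁) :
    ∃ l : ℝ, Tendsto a atTop (𝓝 l) := by
  have hMpos : ∀ t, 0 < M t := fun t ↦ hm₀.trans_le (hbox t).1
  have habsle : ∀ t, |a t| ≤ M t := by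
    intro t
    have h1 := (hbox t).2.2
    have h2 : χ * M t ≤ M t := by nlinarith [hMpos t]
    exact h1.trans h2
  have hrad : ∀ t, 0 ≤ M t ^ 2 - a t ^ 2 := by
    intro t
    have h1 := habsle t
    have h2 := abs_nonneg (a t)
    nlinarith [sq_abs (a t)]
  -- the label area is bounded above by `2 / m₀ ^ 2`
  have hAbd : ∀ t, M t * Kerr.rPlus (M t) (a t) ≤ 2 * m₀⁻¹ ^ 2 := by
    intro t
    have h1 : √(M t ^ 2 - a t ^ 2) ≤ M t := by
      calc √(M t ^ 2 - a t ^ 2) ≤ √(M t ^ 2) := Real.sqrt_le_sqrt (by nlinarith [sq_nonneg (a t)])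
        _ = M t := Real.sqrt_sq (hMpos t).le
    have h2 : M t ≤ m₀⁻¹ := (hbox t).2.1
    have h3 : 0 < M t := hMpos t
    have h4 : M t * M t ≤ m₀⁻¹ * m₀⁻¹ := mul_le_mul h2 h2 h3.le (h3.le.trans h2)
    simp only [Kerr.rPlus]
    nlinarith [h1, h4, h3]
  -- the label area converges (route support `AlmostMonotoneLimit`, landed, applied to `-A`)
  obtain ⟨l, hl⟩ :=
    Summit.FinalStateConjecture.FinalStateConjecture.Theorems.almostMonotoneLimit_proof
      (fun t ↦ -(M t * Kerr.rPlus (M t) (a t))) F T₁ (-(2 * m₀⁻¹ ^ 2))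
      (fun t _ ↦ neg_le_neg (hAbd t))
      (fun t₁ t₂ h₁ h₂ ↦ by
        have h := hmono t₁ t₂ h₁ h₂
        linarith)
      hF
  have hA : Tendsto (fun t ↦ M t * Kerr.rPlus (M t) (a t)) atTop (𝓝 (-l)) := by
    have h := hl.neg
    simp only [neg_neg] at h
    exact h
  -- `Minf > 0`
  have hMinf : m₀ ≤ Minf := ge_of_tendsto hM (Eventually.of_forall fun t ↦ (hbox t).1)
  have hMinf_ne : Minf ≠ 0 := (hm₀.trans_le hMinf).ne'
  -- `a² = M² − (A/M − M)²`
  have hid : ∀ t, a t ^ 2 = M t ^ 2 - (M t * Kerr.rPlus (M t) (a t) / M t - M t) ^ 2 := by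
    intro t
    have hMne : M t ≠ 0 := (hMpos t).ne'
    have h1 : M t * Kerr.rPlus (M t) (a t) / M t - M t = √(M t ^ 2 - a t ^ 2) := by
      rw [mul_div_cancel_left₀ _ hMne]
      simp only [Kerr.rPlus]
      ring
    rw [h1, Real.sq_sqrt (hrad t)]
    ring
  have key : Tendsto (fun t ↦ M t ^ 2 - (M t * Kerr.rPlus (M t) (a t) / M t - M t) ^ 2) atTop
      (𝓝 (Minf ^ 2 - ((-l) / Minf - Minf) ^ 2)) :=
    (hM.pow 2).sub (((hA.div hM hMinf_ne).sub hM).pow 2)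
  exact tendsto_of_continuous_of_sq_tendsto ha (key.congr fun t ↦ (hid t).symm)

/-! ## Composition: the crux BY NAME from the two stubs and `MassFreezing` (real proof, no `sorry`) -/

/-- **S from T, A and M**: pointwise in the development and the hole `i` — `MassFreezing` freezes the mass
label, T localises the event horizon at the labelled outer radius, A (fed by T) makes the label area almost
non-decreasing, `AlmostMonotoneLimit` and the box bound make it converge, and the label algebra + continuity of
the smooth spin label give convergence of `aᵢ`. -/
theorem SpinFreezing_of :
    Sig.stub_innerCollarSwallowed → Sig.stub_labelAreaSecondLaw → MassFreezing → SpinFreezing := by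
  intro hT hA hM X _ _ _ _ _ _ D hD 𝒟 hmax hscri N m₀ χ τ₀ δ₀ M a motion U Ψ ρ U₀ Ψ₀ O hQ i
  -- the mass label converges (route crux `MassFreezing`, by name; identical hypothesis block)
  obtain ⟨Minf, hMlim⟩ := hM X D hD 𝒟 hmax hscri N m₀ χ τ₀ δ₀ M a motion U Ψ ρ U₀ Ψ₀ O hQ i
  -- horizon tracking (T), then the second law read in labels (A)
  have hTi := hT X D hD 𝒟 hmax hscri N m₀ χ τ₀ δ₀ M a motion U Ψ ρ U₀ Ψ₀ O hQ i
  obtain ⟨T₁, F, hF, hmono⟩ := hA X D hD 𝒟 hmax hscri N m₀ χ τ₀ δ₀ M a motion U Ψ ρ U₀ Ψ₀ O hQ i hTi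
  -- box constraints and smoothness of the labels, read off `Q′`
  obtain ⟨hbox, hlab, -⟩ := id hQ
  obtain ⟨-, ha, hbx, -⟩ := hlab i
  exact spin_tendsto_of_mass_tendsto_of_labelArea hbox.1 hbox.2.2.1 ha.continuous hbx hMlim hF hmono

/-- The crux by name, closed modulo the two registered stubs and the route crux `MassFreezing`. -/
theorem spinFreezing_of_stubs : MassFreezing → SpinFreezing :=
  SpinFreezing_of stub_innerCollarSwallowed stub_labelAreaSecondLaw

end Summit.FinalStateConjecture.FinalStateConjecture.Cruxes.SpinFreezing.Birth
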